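import Literature.AlgebraicGeometry.Motives.PolarizationPairingProduct
import Literature.AlgebraicGeometry.HodgeTheory.HardLefschetzNFold
import Mathlib.LinearAlgebra.Vandermonde
import HarnessLib

/-!
# Polarisation of the monomials `x₀ᵏ xʲ` into Lefschetz powers of `x₀ + t x`

Family `hodge`, layer `Literature/AlgebraicGeometry/HodgeTheory` (first half of the assembly of the named
fact `topHodgeClasses_spanned_by_pullbacks`, crux stmt-HodgeConjecture-2782, line `regime-split-middle-step`).
For two degree-`2` classes `x₀, x ∈ H²(T(ℂ); ℂ)` of a `ℂ`-scheme `T`, the binomial theorem for the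
commuting Lefschetz operators (`Motives.lefschetzPow_add_map_cupProduct`, Hatcher Prop. 3.10 / Thm. 3.11,
here with `f = g = 𝟙`) expands `L^m_{x₀ + t x}(1) = Σ_{k+j=m} C(m,k) tʲ · (L^k_{x₀} 1) ⌣ (L^j_x 1)`, and the
invertibility of the Vandermonde matrix `(tʲ)_{0 ≤ t, j ≤ m}` (Mathlib `Matrix.det_vandermonde_ne_zero_iff`)
shows that every monomial `(L^{m-j}_{x₀} 1) ⌣ (L^j_x 1)` is a `ℂ`-combination of the powers
`L^m_{x₀ + t x}(1)`, `t = 0, …, m` (polarisation, Fulton, Young Tableaux, App. B). Also recorded: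
`(L^j_{x₀} 1) ⌣ z = L^j_{x₀} z` and `L^{m-1}_{x₀} x = (L^{m-1}_{x₀} 1) ⌣ (L¹_x 1)` up to degree transport.
Everything is proved; no definitions, no named facts.

## References

* [HatcherAT2002] A. Hatcher, Algebraic Topology, CUP 2002, Prop. 3.10, Thm. 3.11, §3.2 p. 211.
* [FultonYoungTableaux1997] W. Fulton, Young Tableaux, CUP 1997, App. B §B.1 (polarisation).
* [VoisinHodgeI2002] C. Voisin, Hodge Theory and Complex Algebraic Geometry I, CUP 2002, §6.2.3.
-/

noncomputable section

open CategoryTheory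
open Literature.AlgebraicGeometry Literature.AlgebraicGeometry.Motives
open Literature.AlgebraicTopology.SingularHomology Literature.Geometry.Kaehler

namespace Literature.AlgebraicGeometry.HodgeTheory

section HodgeTheory

variable {T : Motives.SchemeOver ℂ}

/-- **Binomial theorem on one space**: `L^m_{x₀ + t•x}(1) = Σ_{k+j=m} C(m,k) tʲ · (L^k_{x₀} 1) ⌣ (L^j_x 1)`
(the summand carries the decidable guard `k + j = m` supplying the degree equation; it holds on the
antidiagonal): `lefschetzPow_add_map_cupProduct` with `f = g = 𝟙`, `α = β = 1`, and `L^j_{t x} = tʲ L^j_x`.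
[cite: HatcherAT2002, Prop. 3.10 and Thm. 3.11] -/
theorem lefschetzPow_add_smul_one_eq_sum (x₀ x : complexBetti T 2) (m : ℕ) (t : ℂ) :
    lefschetzPow (x₀ + t • x) m 0 (singularCohomology.one ℂ (Motives.ComplexPoints T)) =
      ∑ kj ∈ Finset.HasAntidiagonal.antidiagonal m, ((m.choose kj.1 : ℂ) * t ^ kj.2) •
        (if h : kj.1 + kj.2 = m then
          cupProduct (by omega : (0 + 2 * kj.1) + (0 + 2 * kj.2) = 0 + 2 * m)
            (lefschetzPow x₀ kj.1 0 (singularCohomology.one ℂ (Motives.ComplexPoints T)))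
            (lefschetzPow x kj.2 0 (singularCohomology.one ℂ (Motives.ComplexPoints T)))
        else 0) := by
  have h := lefschetzPow_add_map_cupProduct (𝟙 T) (𝟙 T) m (rfl : 0 + 0 = 0) x₀ (t • x)
    (singularCohomology.one ℂ (Motives.ComplexPoints T)) (singularCohomology.one ℂ (Motives.ComplexPoints T))
  simp only [complexBetti.map_id, ModuleCat.id_apply] at h
  rw [one_cupProduct] at h
  rw [h]
  refine Finset.sum_congr rfl fun kj hkj ↦ ?_
  rw [Finset.HasAntidiagonal.mem_antidiagonal] at hkj
  simp only [dif_pos hkj, lefschetzPow_smul, LinearMap.map_smul, smul_smul]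

/-- Sums over the antidiagonal of `m` are sums over `j : Fin (m+1)` of the terms at `(m - j, j)`.
[folklore] -/
theorem sum_antidiagonal_eq_sum_fin {M : Type*} [AddCommMonoid M] (m : ℕ) (F : ℕ × ℕ → M) :
    ∑ kj ∈ Finset.HasAntidiagonal.antidiagonal m, F kj = ∑ j : Fin (m + 1), F (m - j, j) := by
  rw [Finset.Nat.sum_antidiagonal_eq_sum_range_succ_mk, ← Finset.sum_range_reflect, Finset.sum_range]
  refine Finset.sum_congr rfl fun j _ ↦ ?_
  have hj : (j : ℕ) ≤ m := Nat.lt_succ_iff.mp j.isLt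
  rw [Nat.succ_sub_one, Nat.sub_sub_self hj]

/-- The coefficient matrix `(C(m, m-j) tʲ)_{t, j ≤ m}` of the binomial expansions at `t = 0, …, m` has
linearly independent rows (a column-scaled Vandermonde matrix at the distinct nodes `0, …, m`).
[cite: FultonYoungTableaux1997, App. B §B.1] -/
theorem linearIndependent_choose_mul_pow (m : ℕ) :
    LinearIndependent ℂ (fun t : Fin (m + 1) ↦ fun j : Fin (m + 1) ↦
      ((m.choose (m - j) : ℕ) : ℂ) * ((t : ℕ) : ℂ) ^ (j : ℕ)) := by
  set M : Matrix (Fin (m + 1)) (Fin (m + 1)) ℂ := fun t j ↦ ((m.choose (m - j) : ℕ) : ℂ) * ((t : ℕ) : ℂ) ^ (j : ℕ)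
    with hM
  have hMeq : M = Matrix.vandermonde (fun t : Fin (m + 1) ↦ ((t : ℕ) : ℂ)) *
      Matrix.diagonal (fun j : Fin (m + 1) ↦ ((m.choose (m - j) : ℕ) : ℂ)) := by
    ext t j
    rw [Matrix.mul_diagonal, Matrix.vandermonde_apply, hM, mul_comm]
  have hdet : M.det ≠ 0 := by
    rw [hMeq, Matrix.det_mul, Matrix.det_diagonal]
    refine mul_ne_zero ?_ (Finset.prod_ne_zero_iff.mpr fun j _ ↦ ?_)
    · rw [Matrix.det_vandermonde_ne_zero_iff]
      intro a b hab
      have hab' : ((a : ℕ) : ℂ) = ((b : ℕ) : ℂ) := hab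
      exact Fin.ext (by exact_mod_cast hab')
    · exact_mod_cast (Nat.choose_pos (Nat.sub_le m j)).ne'
  have hU : IsUnit M := (Matrix.isUnit_iff_isUnit_det M).mpr (Ne.isUnit hdet)
  exact Matrix.linearIndependent_rows_iff_isUnit.mpr hU

/-- **Polarisation**: every monomial `(L^{m-j}_{x₀} 1) ⌣ (L^j_x 1)` (written with its decidable degree
guard, which holds) is a `ℂ`-combination of the `m`-th Lefschetz powers `L^m_{x₀ + t x}(1)`, `t = 0, …, m`
(binomial expansion and invertibility of the Vandermonde matrix at the nodes `0, …, m`).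
[cite: FultonYoungTableaux1997, App. B §B.1] [cite: HatcherAT2002, Thm. 3.11] -/
theorem cupProduct_lefschetzPow_one_one_mem_span (x₀ x : complexBetti T 2) (m : ℕ) (j₁ : Fin (m + 1)) :
    (fun kj : ℕ × ℕ ↦ (if h : kj.1 + kj.2 = m then
          cupProduct (by omega : (0 + 2 * kj.1) + (0 + 2 * kj.2) = 0 + 2 * m)
            (lefschetzPow x₀ kj.1 0 (singularCohomology.one ℂ (Motives.ComplexPoints T)))
            (lefschetzPow x kj.2 0 (singularCohomology.one ℂ (Motives.ComplexPoints T)))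
        else 0)) (m - j₁, j₁) ∈
      Submodule.span ℂ (Set.range fun t : Fin (m + 1) ↦
        lefschetzPow (x₀ + ((t : ℕ) : ℂ) • x) m 0 (singularCohomology.one ℂ (Motives.ComplexPoints T))) := by
  set w : Fin (m + 1) → complexBetti T (0 + 2 * m) := fun j ↦ (fun kj : ℕ × ℕ ↦ (if h : kj.1 + kj.2 = m then
          cupProduct (by omega : (0 + 2 * kj.1) + (0 + 2 * kj.2) = 0 + 2 * m)
            (lefschetzPow x₀ kj.1 0 (singularCohomology.one ℂ (Motives.ComplexPoints T)))
            (lefschetzPow x kj.2 0 (singularCohomology.one ℂ (Motives.ComplexPoints T)))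
        else 0)) (m - j, j)
    with hw
  set a : Fin (m + 1) → Fin (m + 1) → ℂ := fun t j ↦ ((m.choose (m - j) : ℕ) : ℂ) * ((t : ℕ) : ℂ) ^ (j : ℕ)
    with ha
  let Φ : (Fin (m + 1) → ℂ) →ₗ[ℂ] complexBetti T (0 + 2 * m) := Fintype.linearCombination ℂ w
  have hv : ∀ t : Fin (m + 1), lefschetzPow (x₀ + ((t : ℕ) : ℂ) • x) m 0
      (singularCohomology.one ℂ (Motives.ComplexPoints T)) = Φ (a t) := by
    intro t
    rw [lefschetzPow_add_smul_one_eq_sum, sum_antidiagonal_eq_sum_fin, Fintype.linearCombination_apply]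
  have hspan : Submodule.span ℂ (Set.range a) = ⊤ :=
    (linearIndependent_choose_mul_pow m).span_eq_top_of_card_eq_finrank
      (by rw [Module.finrank_fintype_fun_eq_card, Fintype.card_fin])
  have hmem : (Pi.single j₁ (1 : ℂ) : Fin (m + 1) → ℂ) ∈ Submodule.span ℂ (Set.range a) := by
    rw [hspan]; exact Submodule.mem_top
  have himg : Φ (Pi.single j₁ (1 : ℂ)) ∈ Submodule.map Φ (Submodule.span ℂ (Set.range a)) :=
    Submodule.mem_map_of_mem hmem
  rw [Fintype.linearCombination_apply_single, one_smul, Submodule.map_span, ← Set.range_comp] at himg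
  rw [show (fun t : Fin (m + 1) ↦ lefschetzPow (x₀ + ((t : ℕ) : ℂ) • x) m 0
      (singularCohomology.one ℂ (Motives.ComplexPoints T))) = Φ ∘ a from funext hv]
  exact himg

/-! ### Lefschetz powers on the unit versus on a class -/

/-- `(L^j_{x₀} 1) ⌣ z = L^j_{x₀} z` up to degree transport (associativity of `⌣` and `1 ⌣ z = z`).
[cite: HatcherAT2002, §3.2 p. 211] -/
theorem cupProduct_lefschetzPow_one :
    ∀ (x₀ : complexBetti T 2) (j : ℕ) {q s : ℕ} (hs : (0 + 2 * j) + q = s) (z : complexBetti T q),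
      cupProduct hs (lefschetzPow x₀ j 0 (singularCohomology.one ℂ (Motives.ComplexPoints T))) z =
        complexBetti.degCast T (by omega : q + 2 * j = s) (lefschetzPow x₀ j q z)
  | x₀, 0, q, s, hs, z => by
    have hq : q = s := by omega
    subst hq
    exact one_cupProduct z
  | x₀, j + 1, q, s, hs, z => by
    rw [lefschetzPow_succ, LinearMap.comp_apply, lefschetzOperator_apply,
      cupProduct_assoc _ (by omega : (0 + 2 * j) + q = q + 2 * j) hs (by omega : 2 + (q + 2 * j) = s),
      cupProduct_lefschetzPow_one x₀ j (by omega : (0 + 2 * j) + q = q + 2 * j) z, complexBetti.degCast_rfl,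
      lefschetzPow_succ, LinearMap.comp_apply, lefschetzOperator_apply, degCast_cupProduct]

/-- Composition of degree transports. [folklore] -/
theorem degCast_degCast {a b c : ℕ} (h₁ : a = b) (h₂ : b = c) (y : complexBetti T a) :
    complexBetti.degCast T h₂ (complexBetti.degCast T h₁ y) = complexBetti.degCast T (h₁.trans h₂) y := by
  subst h₂; subst h₁; rfl

/-- `lefschetzPowTo` is `lefschetzPow` followed by the degree transport. [folklore] -/
theorem lefschetzPowTo_eq_degCast (κ : complexBetti T 2) (j k m : ℕ) (hm : k + 2 * j = m) (y : complexBetti T k) :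
    lefschetzPowTo κ j k m hm y = complexBetti.degCast T hm (lefschetzPow κ j k y) := by
  subst hm; rfl

/-- **`L^{m-1}_{x₀}(x) = x₀^{m-1} x`**: the iterated Lefschetz operator of `x₀` on a degree-`2` class `x`,
written in the target degree `2m`, is the transport of the monomial `(L^{m-1}_{x₀} 1) ⌣ (L¹_x 1)`.
[cite: HatcherAT2002, §3.2 p. 211] -/
theorem lefschetzPowTo_eq_degCast_cupProduct (x₀ x : complexBetti T 2) {m : ℕ}
    (hm : 2 + 2 * (m - 1) = 2 * m) :
    lefschetzPowTo x₀ (m - 1) 2 (2 * m) hm x =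
      complexBetti.degCast T (Nat.zero_add (2 * m))
        (cupProduct (by omega : (0 + 2 * (m - 1)) + (0 + 2 * 1) = 0 + 2 * m)
          (lefschetzPow x₀ (m - 1) 0 (singularCohomology.one ℂ (Motives.ComplexPoints T)))
          (lefschetzPow x 1 0 (singularCohomology.one ℂ (Motives.ComplexPoints T)))) := by
  rw [lefschetzPow_succ_one_eq_degCast x 0, cupProduct_degCast_right, lefschetzPow_zero, LinearMap.id_apply,
    cupProduct_lefschetzPow_one x₀ (m - 1) (by omega : (0 + 2 * (m - 1)) + 2 = 0 + 2 * m) x,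
    degCast_degCast, lefschetzPowTo_eq_degCast]

end HodgeTheory

end Literature.AlgebraicGeometry.HodgeTheory

end
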